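import Summits.KontsevichZagierPeriods.Zeta5Search.Barrier.ConeGammaTranslateConvexity
import Summits.KontsevichZagierPeriods.Zeta5Search.Barrier.ConeGammaCuspRays

/-!
# ζ(5) search — BARRIER: THE CONVEXITY TYPE AT THE CLOSED ORBIT IS DECIDED AT THE RAYS OF THE RATE ARRANGEMENT
# (file (5) of «CONVEXITY TYPE», sequel)

HONEST FRAMING (cell `pub-zeta5`): systematic search; no irrationality claim unless kernel-certified. MODEL objects
under Brown–Zudilin's (28)+(30) accounting ([BZ22] = arXiv:2210.03391; (28) observed, not proved); nothing here is a
statement about `ζ(5)`, any `γ` of record, the cone's supremum (C2 OPEN) or the value / sign / convexity type of the cusp slope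
at a named direction (DATA of the cell); no ray at a named direction is asserted or evaluated; NO cancellation is quantified;
S-E / (TD_A) stay CONJECTURED; records in print UNMOVED. Prover P2 g44 (item «CONVEXITY TYPE», sequel file (5); plan INBOX
2026-08-28). Sources: files (3) `ConeGammaCuspSlopeConvexityOrbit`, (4) `ConeGammaTranslateConvexity`, P2 g35
`ConeGammaCuspRays` (`exists_ray_pos_of_pos`: a chamber functional with zero weight sum that is positive somewhere in a closed
chamber is positive at a RAY of that chamber — Schrijver §8.5 in the tree), P2 g33 `canonical_greedy_sum_eq_zero`.

SETTING as in file (1). A RAY of the rate arrangement (P2 g35): a displacement `x` with rates in `[0, 1]`, two of them distinct,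
whose tie pattern is rigid (every tie-preserving displacement lies in `span{x, s(a)}`); the set of rays depends on the direction `a`
alone and is finite modulo `x ↦ u•x + t•s(a)` (P2 g35 (3)). File (3): `σ` is convex on `ℝ⁸` iff EVERY chamber functional is `≤ σ`
EVERYWHERE. Here «everywhere» becomes «at the rays»:
* **`convexOn_univ_cuspSlope_iff_forall_ray`** — `σ` is convex on `ℝ⁸` iff `Σ_k W_k(δ₀)·r_k(x) ≤ σ(x)` for every generic `δ₀` and
  every RAY `x` (⇐: if `L_{δ₀}(Δ) > σ(Δ) = L_{δ₁}(Δ)` for `δ₁` refining `Δ`, the functional `L_{δ₀} − L_{δ₁}` has zero weight sum and is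
  positive in the closed chamber of `δ₁`, hence positive at a ray of that chamber, where `σ = L_{δ₁}`);
  **`concaveOn_univ_cuspSlope_iff_forall_ray`** — the twin; **`subadditive_cuspSlope_iff_forall_ray`** /
  **`superadditive_cuspSlope_iff_forall_ray`**;
* **`convexOn_translateIntegral_nhds_zero_iff_forall_ray`** — the translate integral `P` is convex near the closed orbit iff
  the same ray condition holds (file (4)); the concave twin.
So the convexity type of the MODEL cusp at the closed orbit is a FINITE check on the cell's own objects: one inequality per
(generic order, ray) pair — no instance asserted.
NOT here (honest): the list of rays or of realised orders at any named direction, any value of `σ` or `W_k` there (DATA);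
`Φ`, `γ` of record, C2, S-E, `ζ(5)`.
-/

noncomputable section

open Set Finset Filter
open scoped Topology

namespace Summit.KontsevichZagierPeriods.Zeta5Search.Barrier.ConeGamma

/-! ### Differences of chamber functionals -/

/-- The difference of two chamber functionals is the chamber functional of the weight difference. -/
theorem greedy_sub_greedy_eq_sum (a : Dir) (W W' : Fin 28 → ℝ) (Δ : Fin 8 → ℝ) :
    ∑ k, W k * (phiForm Δ k / h28 a k) - ∑ k, W' k * (phiForm Δ k / h28 a k) =
      ∑ k, (W k - W' k) * (phiForm Δ k / h28 a k) := by
  rw [← Finset.sum_sub_distrib]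
  exact Finset.sum_congr rfl fun k _ => by ring

/-- **The difference of two canonical chamber weight vectors has zero sum** (each sums to zero, P2 g33). -/
theorem canonical_greedy_sub_sum_eq_zero {a : Dir} (hpos : ∀ k, 0 < h28 a k) {T : ℝ} (hT : 0 < T)
    (hper : ∀ k : Fin 28, ∃ z : ℤ, T * h28 a k = z) {F : Finset (Fin 28) → ℝ}
    (hF : ∀ A, F A = ∑ m ∈ Finset.range ((bkpts a T).card - 1), ((patternN a (bkpt a T m) A : ℤ) : ℝ))
    {δ₀ δ₁ : Fin 8 → ℝ} (hgen : ∀ k l : Fin 28, k ≠ l → phiForm δ₀ k / h28 a k ≠ phiForm δ₀ l / h28 a l)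
    (hgen₁ : ∀ k l : Fin 28, k ≠ l → phiForm δ₁ k / h28 a k ≠ phiForm δ₁ l / h28 a l) :
    ∑ k, ((F (Finset.univ.filter fun l => phiForm δ₀ k / h28 a k ≤ phiForm δ₀ l / h28 a l) -
          F (Finset.univ.filter fun l => phiForm δ₀ k / h28 a k < phiForm δ₀ l / h28 a l)) -
        (F (Finset.univ.filter fun l => phiForm δ₁ k / h28 a k ≤ phiForm δ₁ l / h28 a l) -
          F (Finset.univ.filter fun l => phiForm δ₁ k / h28 a k < phiForm δ₁ l / h28 a l))) = 0 := by
  rw [Finset.sum_sub_distrib, canonical_greedy_sum_eq_zero hpos hT hper hF hgen,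
    canonical_greedy_sum_eq_zero hpos hT hper hF hgen₁, sub_zero]

/-! ### Convexity at the closed orbit is decided at the rays -/

/-- **`σ` IS CONVEX ON `ℝ⁸` IFF EVERY CHAMBER FUNCTIONAL UNDER-ESTIMATES `σ` AT EVERY RAY.** All 28 forms of `a` positive,
`T > 0` a period, `F` the canonical period pattern function. Then `ConvexOn ℝ univ (cuspSlope a T)` iff for every generic `δ₀`
and every ray `x` of the rate arrangement (rates in `[0,1]`, two distinct, rigid tie pattern):
`Σ_k W_k(δ₀)·φ_k(x)/h_k(a) ≤ cuspSlope a T x` — a finite test (one inequality per generic order and ray, modulo the gauge). -/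
theorem convexOn_univ_cuspSlope_iff_forall_ray {a : Dir} (hpos : ∀ k, 0 < h28 a k) {T : ℝ} (hT : 0 < T)
    (hper : ∀ k : Fin 28, ∃ z : ℤ, T * h28 a k = z) {F : Finset (Fin 28) → ℝ}
    (hF : ∀ A, F A = ∑ m ∈ Finset.range ((bkpts a T).card - 1), ((patternN a (bkpt a T m) A : ℤ) : ℝ)) :
    ConvexOn ℝ Set.univ (cuspSlope a T) ↔
      ∀ δ₀ : Fin 8 → ℝ, (∀ k l : Fin 28, k ≠ l → phiForm δ₀ k / h28 a k ≠ phiForm δ₀ l / h28 a l) →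
        ∀ x : Fin 8 → ℝ, (∀ k, 0 ≤ phiForm x k / h28 a k ∧ phiForm x k / h28 a k ≤ 1) →
          ((∃ k l, phiForm x k / h28 a k ≠ phiForm x l / h28 a l) ∧
            ∀ d : Fin 8 → ℝ, (∀ k l, phiForm x k / h28 a k = phiForm x l / h28 a l →
              phiForm d k / h28 a k = phiForm d l / h28 a l) → ∃ u t : ℝ, d = u • x + t • sParam a) →
          ∑ k, (F (Finset.univ.filter fun l => phiForm δ₀ k / h28 a k ≤ phiForm δ₀ l / h28 a l) -
              F (Finset.univ.filter fun l => phiForm δ₀ k / h28 a k < phiForm δ₀ l / h28 a l)) *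
            (phiForm x k / h28 a k) ≤ cuspSlope a T x := by
  rw [convexOn_univ_cuspSlope_iff_greedy_le hpos hT hper hF]
  refine ⟨fun h δ₀ hgen x _ _ => h δ₀ hgen x, fun h δ₀ hgen Δ => ?_⟩
  by_contra hlt
  obtain ⟨δ₁, hgen₁, href₁⟩ := exists_generic_refines hpos Δ
  have hσΔ := cuspSlope_eq_greedy_canonical_of_refines hpos hT hper hF hgen₁ Δ href₁
  -- the functional `L_{δ₀} − L_{δ₁}` has zero weight sum and is positive at `Δ`, in the closed chamber of `δ₁`
  have hval : 0 < ∑ k, ((F (Finset.univ.filter fun l => phiForm δ₀ k / h28 a k ≤ phiForm δ₀ l / h28 a l) -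
        F (Finset.univ.filter fun l => phiForm δ₀ k / h28 a k < phiForm δ₀ l / h28 a l)) -
      (F (Finset.univ.filter fun l => phiForm δ₁ k / h28 a k ≤ phiForm δ₁ l / h28 a l) -
        F (Finset.univ.filter fun l => phiForm δ₁ k / h28 a k < phiForm δ₁ l / h28 a l))) *
      (phiForm Δ k / h28 a k) := by
    rw [← greedy_sub_greedy_eq_sum, ← hσΔ]
    linarith [not_le.mp hlt]
  obtain ⟨x, hxref, hx01, hray, -, hxval⟩ :=
    exists_ray_pos_of_pos hpos hgen₁ (canonical_greedy_sub_sum_eq_zero hpos hT hper hF hgen hgen₁) href₁ hval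
  rw [← greedy_sub_greedy_eq_sum, ← cuspSlope_eq_greedy_canonical_of_refines hpos hT hper hF hgen₁ x hxref] at hxval
  have hx := h δ₀ hgen x hx01 hray
  linarith

/-- **`σ` IS CONCAVE ON `ℝ⁸` IFF EVERY CHAMBER FUNCTIONAL OVER-ESTIMATES `σ` AT EVERY RAY** (twin). -/
theorem concaveOn_univ_cuspSlope_iff_forall_ray {a : Dir} (hpos : ∀ k, 0 < h28 a k) {T : ℝ} (hT : 0 < T)
    (hper : ∀ k : Fin 28, ∃ z : ℤ, T * h28 a k = z) {F : Finset (Fin 28) → ℝ}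
    (hF : ∀ A, F A = ∑ m ∈ Finset.range ((bkpts a T).card - 1), ((patternN a (bkpt a T m) A : ℤ) : ℝ)) :
    ConcaveOn ℝ Set.univ (cuspSlope a T) ↔
      ∀ δ₀ : Fin 8 → ℝ, (∀ k l : Fin 28, k ≠ l → phiForm δ₀ k / h28 a k ≠ phiForm δ₀ l / h28 a l) →
        ∀ x : Fin 8 → ℝ, (∀ k, 0 ≤ phiForm x k / h28 a k ∧ phiForm x k / h28 a k ≤ 1) →
          ((∃ k l, phiForm x k / h28 a k ≠ phiForm x l / h28 a l) ∧
            ∀ d : Fin 8 → ℝ, (∀ k l, phiForm x k / h28 a k = phiForm x l / h28 a l →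
              phiForm d k / h28 a k = phiForm d l / h28 a l) → ∃ u t : ℝ, d = u • x + t • sParam a) →
          cuspSlope a T x ≤ ∑ k, (F (Finset.univ.filter fun l => phiForm δ₀ k / h28 a k ≤ phiForm δ₀ l / h28 a l) -
              F (Finset.univ.filter fun l => phiForm δ₀ k / h28 a k < phiForm δ₀ l / h28 a l)) *
            (phiForm x k / h28 a k) := by
  rw [concaveOn_univ_cuspSlope_iff_le_greedy hpos hT hper hF]
  refine ⟨fun h δ₀ hgen x _ _ => h δ₀ hgen x, fun h δ₀ hgen Δ => ?_⟩
  by_contra hlt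
  obtain ⟨δ₁, hgen₁, href₁⟩ := exists_generic_refines hpos Δ
  have hσΔ := cuspSlope_eq_greedy_canonical_of_refines hpos hT hper hF hgen₁ Δ href₁
  -- the functional `L_{δ₁} − L_{δ₀}` has zero weight sum and is positive at `Δ`, in the closed chamber of `δ₁`
  have hval : 0 < ∑ k, ((F (Finset.univ.filter fun l => phiForm δ₁ k / h28 a k ≤ phiForm δ₁ l / h28 a l) -
        F (Finset.univ.filter fun l => phiForm δ₁ k / h28 a k < phiForm δ₁ l / h28 a l)) -
      (F (Finset.univ.filter fun l => phiForm δ₀ k / h28 a k ≤ phiForm δ₀ l / h28 a l) -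
        F (Finset.univ.filter fun l => phiForm δ₀ k / h28 a k < phiForm δ₀ l / h28 a l))) *
      (phiForm Δ k / h28 a k) := by
    rw [← greedy_sub_greedy_eq_sum, ← hσΔ]
    linarith [not_le.mp hlt]
  obtain ⟨x, hxref, hx01, hray, -, hxval⟩ :=
    exists_ray_pos_of_pos hpos hgen₁ (canonical_greedy_sub_sum_eq_zero hpos hT hper hF hgen₁ hgen) href₁ hval
  rw [← greedy_sub_greedy_eq_sum, ← cuspSlope_eq_greedy_canonical_of_refines hpos hT hper hF hgen₁ x hxref] at hxval
  have hx := h δ₀ hgen x hx01 hray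
  linarith

/-- **SUBADDITIVITY OF `σ` IS DECIDED AT THE RAYS**: `σ(Δ + Δ') ≤ σ(Δ) + σ(Δ')` for all `Δ, Δ'` iff every chamber functional
under-estimates `σ` at every ray (files (3) and the above). -/
theorem subadditive_cuspSlope_iff_forall_ray {a : Dir} (hpos : ∀ k, 0 < h28 a k) {T : ℝ} (hT : 0 < T)
    (hper : ∀ k : Fin 28, ∃ z : ℤ, T * h28 a k = z) {F : Finset (Fin 28) → ℝ}
    (hF : ∀ A, F A = ∑ m ∈ Finset.range ((bkpts a T).card - 1), ((patternN a (bkpt a T m) A : ℤ) : ℝ)) :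
    (∀ Δ Δ' : Fin 8 → ℝ, cuspSlope a T (Δ + Δ') ≤ cuspSlope a T Δ + cuspSlope a T Δ') ↔
      ∀ δ₀ : Fin 8 → ℝ, (∀ k l : Fin 28, k ≠ l → phiForm δ₀ k / h28 a k ≠ phiForm δ₀ l / h28 a l) →
        ∀ x : Fin 8 → ℝ, (∀ k, 0 ≤ phiForm x k / h28 a k ∧ phiForm x k / h28 a k ≤ 1) →
          ((∃ k l, phiForm x k / h28 a k ≠ phiForm x l / h28 a l) ∧
            ∀ d : Fin 8 → ℝ, (∀ k l, phiForm x k / h28 a k = phiForm x l / h28 a l →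
              phiForm d k / h28 a k = phiForm d l / h28 a l) → ∃ u t : ℝ, d = u • x + t • sParam a) →
          ∑ k, (F (Finset.univ.filter fun l => phiForm δ₀ k / h28 a k ≤ phiForm δ₀ l / h28 a l) -
              F (Finset.univ.filter fun l => phiForm δ₀ k / h28 a k < phiForm δ₀ l / h28 a l)) *
            (phiForm x k / h28 a k) ≤ cuspSlope a T x := by
  rw [← convexOn_univ_cuspSlope_iff_subadditive hpos hT hper, convexOn_univ_cuspSlope_iff_forall_ray hpos hT hper hF]

/-- **SUPERADDITIVITY OF `σ` IS DECIDED AT THE RAYS** (twin). -/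
theorem superadditive_cuspSlope_iff_forall_ray {a : Dir} (hpos : ∀ k, 0 < h28 a k) {T : ℝ} (hT : 0 < T)
    (hper : ∀ k : Fin 28, ∃ z : ℤ, T * h28 a k = z) {F : Finset (Fin 28) → ℝ}
    (hF : ∀ A, F A = ∑ m ∈ Finset.range ((bkpts a T).card - 1), ((patternN a (bkpt a T m) A : ℤ) : ℝ)) :
    (∀ Δ Δ' : Fin 8 → ℝ, cuspSlope a T Δ + cuspSlope a T Δ' ≤ cuspSlope a T (Δ + Δ')) ↔
      ∀ δ₀ : Fin 8 → ℝ, (∀ k l : Fin 28, k ≠ l → phiForm δ₀ k / h28 a k ≠ phiForm δ₀ l / h28 a l) →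
        ∀ x : Fin 8 → ℝ, (∀ k, 0 ≤ phiForm x k / h28 a k ∧ phiForm x k / h28 a k ≤ 1) →
          ((∃ k l, phiForm x k / h28 a k ≠ phiForm x l / h28 a l) ∧
            ∀ d : Fin 8 → ℝ, (∀ k l, phiForm x k / h28 a k = phiForm x l / h28 a l →
              phiForm d k / h28 a k = phiForm d l / h28 a l) → ∃ u t : ℝ, d = u • x + t • sParam a) →
          cuspSlope a T x ≤ ∑ k, (F (Finset.univ.filter fun l => phiForm δ₀ k / h28 a k ≤ phiForm δ₀ l / h28 a l) -
              F (Finset.univ.filter fun l => phiForm δ₀ k / h28 a k < phiForm δ₀ l / h28 a l)) *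
            (phiForm x k / h28 a k) := by
  rw [← concaveOn_univ_cuspSlope_iff_superadditive hpos hT hper, concaveOn_univ_cuspSlope_iff_forall_ray hpos hT hper hF]

/-! ### The translate integral at the closed orbit -/

/-- **`P` IS CONVEX NEAR THE CLOSED ORBIT IFF EVERY CHAMBER FUNCTIONAL UNDER-ESTIMATES `σ` AT EVERY RAY** (file (4) + the
ray criterion): a finite check on the direction's rays and generic orders — no instance asserted. -/
theorem convexOn_translateIntegral_nhds_zero_iff_forall_ray {a : Dir} (hpos : ∀ k, 0 < h28 a k) {T : ℝ} (hT : 0 < T)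
    (hper : ∀ k : Fin 28, ∃ z : ℤ, T * h28 a k = z) {F : Finset (Fin 28) → ℝ}
    (hF : ∀ A, F A = ∑ m ∈ Finset.range ((bkpts a T).card - 1), ((patternN a (bkpt a T m) A : ℤ) : ℝ)) :
    (∃ U ∈ 𝓝 (0 : Fin 8 → ℝ), ConvexOn ℝ U (translateIntegral a T)) ↔
      ∀ δ₀ : Fin 8 → ℝ, (∀ k l : Fin 28, k ≠ l → phiForm δ₀ k / h28 a k ≠ phiForm δ₀ l / h28 a l) →
        ∀ x : Fin 8 → ℝ, (∀ k, 0 ≤ phiForm x k / h28 a k ∧ phiForm x k / h28 a k ≤ 1) →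
          ((∃ k l, phiForm x k / h28 a k ≠ phiForm x l / h28 a l) ∧
            ∀ d : Fin 8 → ℝ, (∀ k l, phiForm x k / h28 a k = phiForm x l / h28 a l →
              phiForm d k / h28 a k = phiForm d l / h28 a l) → ∃ u t : ℝ, d = u • x + t • sParam a) →
          ∑ k, (F (Finset.univ.filter fun l => phiForm δ₀ k / h28 a k ≤ phiForm δ₀ l / h28 a l) -
              F (Finset.univ.filter fun l => phiForm δ₀ k / h28 a k < phiForm δ₀ l / h28 a l)) *
            (phiForm x k / h28 a k) ≤ cuspSlope a T x := by
  rw [convexOn_translateIntegral_nhds_zero_iff_subadditive hpos hT hper, subadditive_cuspSlope_iff_forall_ray hpos hT hper hF]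

/-- **`P` IS CONCAVE NEAR THE CLOSED ORBIT IFF EVERY CHAMBER FUNCTIONAL OVER-ESTIMATES `σ` AT EVERY RAY** (twin). -/
theorem concaveOn_translateIntegral_nhds_zero_iff_forall_ray {a : Dir} (hpos : ∀ k, 0 < h28 a k) {T : ℝ} (hT : 0 < T)
    (hper : ∀ k : Fin 28, ∃ z : ℤ, T * h28 a k = z) {F : Finset (Fin 28) → ℝ}
    (hF : ∀ A, F A = ∑ m ∈ Finset.range ((bkpts a T).card - 1), ((patternN a (bkpt a T m) A : ℤ) : ℝ)) :
    (∃ U ∈ 𝓝 (0 : Fin 8 → ℝ), ConcaveOn ℝ U (translateIntegral a T)) ↔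
      ∀ δ₀ : Fin 8 → ℝ, (∀ k l : Fin 28, k ≠ l → phiForm δ₀ k / h28 a k ≠ phiForm δ₀ l / h28 a l) →
        ∀ x : Fin 8 → ℝ, (∀ k, 0 ≤ phiForm x k / h28 a k ∧ phiForm x k / h28 a k ≤ 1) →
          ((∃ k l, phiForm x k / h28 a k ≠ phiForm x l / h28 a l) ∧
            ∀ d : Fin 8 → ℝ, (∀ k l, phiForm x k / h28 a k = phiForm x l / h28 a l →
              phiForm d k / h28 a k = phiForm d l / h28 a l) → ∃ u t : ℝ, d = u • x + t • sParam a) →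
          cuspSlope a T x ≤ ∑ k, (F (Finset.univ.filter fun l => phiForm δ₀ k / h28 a k ≤ phiForm δ₀ l / h28 a l) -
              F (Finset.univ.filter fun l => phiForm δ₀ k / h28 a k < phiForm δ₀ l / h28 a l)) *
            (phiForm x k / h28 a k) := by
  rw [concaveOn_translateIntegral_nhds_zero_iff_superadditive hpos hT hper,
    superadditive_cuspSlope_iff_forall_ray hpos hT hper hF]

end Summit.KontsevichZagierPeriods.Zeta5Search.Barrier.ConeGamma

end
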